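import Summits.QuantumFields.YangMills.Theorems.LuscherReductionTwistedTraceScalingOrthoTubeCoords
import Summits.QuantumFields.YangMills.Theorems.LuscherReductionTwistedTraceScalingSlowDisintegrationTubes
import Summits.QuantumFields.YangMills.Theorems.LuscherReductionTwistedTraceScalingTubeBOPackage
import HarnessLib

/-!
# THE BORN–OPPENHEIMER PROJECTION in the polar-mean chart: `P f = φ_f(slowMean U)·Ω(relLinkVec U)`, with EXACT Pythagoras `‖Pf‖²_w + ‖f − Pf‖²_w = ‖f‖²_w`
# (lane A of S-BASE, crux `TwistedTraceScaling` stmt-QuantumFields-20203, C4 INNER; design note `pub/ym-fleet/ym-luscher-20007-p1/COARSE-DESIGN.md` §24.3/§24.4 (G))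

The splitting `f = u + v` of `SoftTubeBOPackageOn` is `u = P f`, the fibrewise `w`-orthogonal projection onto a fixed fibre profile `Ω` over a slow window `𝒰`, in the
coordinates `(slowMean, relLinkVec)` of the orthographic tube.  THIS FILE defines it WITHOUT inverting the chart and proves the exact identities the package's MASS clause needs:
* `boFun φ Ω U = 𝟙_{orthoTubeSet}(U)·φ(slowMean U)·Ω(relLinkVec U)` — a global function; on the tube `boFun φ Ω (orthoTube u v) = φ(u)Ω(v)` (`slowMean_orthoTube`, `relLinkVec_orthoTube`);
* `fibreInner w Ω f u = ∫ f(orthoTube u v)Ω(v)w(orthoTube u v) dπ(v)`, `fibreMass w Ω u = ∫ Ω(v)²w(orthoTube u v) dπ(v)` (`π = orthoTransverse`), `boCoeff = 𝟙_𝒰·fibreInner/fibreMass`,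
  `boProj w Ω 𝒰 f = boFun (boCoeff w Ω 𝒰 f) Ω`;
* measurability / boundedness (`fibreMass ≥ Z₀ > 0` on `𝒰`), LINEARITY `boProj (Σ aᵢfᵢ) = Σ aᵢ boProj fᵢ`;
* ★★ `integral_boFun_mul_eq` — the one-site disintegration of `∫ boFun φ Ω · g · w` as `∫ φ(u)·fibreInner w Ω g u du` (exact; `integral_configMeasure_orthoTube` + Fubini);
* ★★★ `tubeNormSq_boProj_add` — `tubeNormSq w (boProj f) + tubeNormSq w (f − boProj f) = tubeNormSq w f` EXACTLY (MASS), and `v = f − Pf` is fibrewise `w`-orthogonal to `Ω`.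
No smallness, no `β`: pure measure theory on the tube.
HONEST FRAMING: bookkeeping for a stub of a child of the CONDITIONAL reduction route R2b1; no spectral claim; C4 OPEN; not a gap, not Clay.
-/

set_option autoImplicit false

noncomputable section

open MeasureTheory Filter Topology Real
open scoped BigOperators
open Literature.MathematicalPhysics.QuantumFieldTheory
open Literature.MathematicalPhysics.QuantumLattice

namespace Summit.QuantumFields.YangMills.Theorems.FemtoTransferGap.TwoLattice.ConstTube

open Summit.QuantumFields.YangMills.Theorems.FemtoTransferGap
open Summit.QuantumFields.YangMills.Theorems.FemtoTransferGap.TwoLattice.Stiff (LinkSpace)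

variable (L : ℕ) [NeZero L]

/-! ## §1 Born–Oppenheimer functions in the polar-mean chart -/

/-- **BO function** `boFun φ Ω U = 𝟙_{orthoTubeSet}(U)·φ(slowMean U)·Ω(relLinkVec U)`: slow amplitude × fibre profile, as a global function of the links. [cite: Luscher1983, §3] -/
def boFun (φ : GaugeConfig 3 1 SU2 → ℝ) (Ω : LinkSpace L → ℝ) : GaugeConfig 3 L SU2 → ℝ :=
  fun U => (orthoTubeSet L).indicator (fun _ => (1 : ℝ)) U * (φ (slowMean L U) * Ω (relLinkVec L U))

/-- On the tube: `boFun φ Ω (orthoTube u v) = φ(u)·Ω(v)`. [folklore] -/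
theorem boFun_orthoTube (φ : GaugeConfig 3 1 SU2 → ℝ) (Ω : LinkSpace L → ℝ) (u : GaugeConfig 3 1 SU2) {v : Edge 3 L → Fin 3 → ℝ} (hv : v ∈ capBalancedSet L) :
    boFun L φ Ω (orthoTube L u v) = φ u * Ω (linkEmbed L v) := by
  unfold boFun
  rw [Set.indicator_of_mem (orthoTube_mem L u hv), one_mul, slowMean_orthoTube L u hv, relLinkVec_orthoTube L u hv]

/-- Off the tube `boFun` vanishes. [folklore] -/
theorem boFun_eq_zero_of_not_mem (φ : GaugeConfig 3 1 SU2 → ℝ) (Ω : LinkSpace L → ℝ) {U : GaugeConfig 3 L SU2} (hU : U ∉ orthoTubeSet L) : boFun L φ Ω U = 0 := by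
  unfold boFun; rw [Set.indicator_of_notMem hU, zero_mul]

/-- `slowMean` is measurable. [folklore] -/
theorem measurable_slowMean : Measurable (slowMean L) := measurable_pi_lambda _ fun e => measurable_polarMean L e.2

omit [NeZero L] in
/-- `linkEmbed` is measurable. [folklore] -/
theorem measurable_linkEmbed : Measurable (linkEmbed L) := by
  have h : Measurable fun w : Edge 3 L → Fin 3 → ℝ => fun ea : Edge 3 L × Fin 3 => w ea.1 ea.2 :=
    measurable_pi_lambda _ fun ea => (measurable_pi_apply ea.2).comp (measurable_pi_apply ea.1)
  exact (MeasurableEquiv.toLp 2 (Edge 3 L × Fin 3 → ℝ)).measurable.comp h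

/-- `boFun φ Ω` is measurable for measurable data. [folklore] -/
theorem measurable_boFun {φ : GaugeConfig 3 1 SU2 → ℝ} (hφ : Measurable φ) {Ω : LinkSpace L → ℝ} (hΩ : Measurable Ω) : Measurable (boFun L φ Ω) :=
  (measurable_const.indicator (measurableSet_orthoTubeSet L)).mul ((hφ.comp (measurable_slowMean L)).mul (hΩ.comp (measurable_relLinkVec L)))

/-- `|boFun φ Ω| ≤ Cφ·CΩ`. [folklore] -/
theorem abs_boFun_le {φ : GaugeConfig 3 1 SU2 → ℝ} {Cφ : ℝ} (hCφ : ∀ u, |φ u| ≤ Cφ) {Ω : LinkSpace L → ℝ} {CΩ : ℝ} (hCΩ : ∀ x, |Ω x| ≤ CΩ) (U : GaugeConfig 3 L SU2) :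
    |boFun L φ Ω U| ≤ Cφ * CΩ := by
  have hCφ0 : 0 ≤ Cφ := (abs_nonneg _).trans (hCφ 1)
  have hprod : |φ (slowMean L U) * Ω (relLinkVec L U)| ≤ Cφ * CΩ := by
    rw [abs_mul]; exact mul_le_mul (hCφ _) (hCΩ _) (abs_nonneg _) hCφ0
  unfold boFun
  by_cases h : U ∈ orthoTubeSet L
  · rw [Set.indicator_of_mem h, one_mul]; exact hprod
  · rw [Set.indicator_of_notMem h, zero_mul, abs_zero]; exact (abs_nonneg _).trans hprod

/-! ## §2 Fibre integrals and the projection -/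

/-- The fibre pairing `∫ f(orthoTube u v)·Ω(v)·w(orthoTube u v) dπ(v)`. [folklore] -/
def fibreInner (w : GaugeConfig 3 L SU2 → ℝ) (Ω : LinkSpace L → ℝ) (f : GaugeConfig 3 L SU2 → ℝ) (u : GaugeConfig 3 1 SU2) : ℝ :=
  ∫ v, f (orthoTube L u v) * Ω (linkEmbed L v) * w (orthoTube L u v) ∂orthoTransverse L

/-- The fibre mass `∫ Ω(v)²·w(orthoTube u v) dπ(v)`. [folklore] -/
def fibreMass (w : GaugeConfig 3 L SU2 → ℝ) (Ω : LinkSpace L → ℝ) (u : GaugeConfig 3 1 SU2) : ℝ :=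
  ∫ v, Ω (linkEmbed L v) ^ 2 * w (orthoTube L u v) ∂orthoTransverse L

/-- The BO slow coefficient of `f`: `𝟙_𝒰(u)·fibreInner/fibreMass`. [cite: Luscher1983, §3] -/
def boCoeff (w : GaugeConfig 3 L SU2 → ℝ) (Ω : LinkSpace L → ℝ) (𝒰 : Set (GaugeConfig 3 1 SU2)) (f : GaugeConfig 3 L SU2 → ℝ) : GaugeConfig 3 1 SU2 → ℝ :=
  𝒰.indicator fun u => fibreInner L w Ω f u / fibreMass L w Ω u

/-- ★ **The Born–Oppenheimer projection** `P f = boFun (boCoeff f) Ω`. [cite: Luscher1983, §3] [cite: SjostrandZworski2007, §2] -/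
def boProj (w : GaugeConfig 3 L SU2 → ℝ) (Ω : LinkSpace L → ℝ) (𝒰 : Set (GaugeConfig 3 1 SU2)) (f : GaugeConfig 3 L SU2 → ℝ) : GaugeConfig 3 L SU2 → ℝ :=
  boFun L (boCoeff L w Ω 𝒰 f) Ω

variable {L}

omit [NeZero L] in
/-- Joint measurability of `(u, v) ↦ g(orthoTube u v)`. [folklore] -/
theorem measurable_comp_orthoTube {g : GaugeConfig 3 L SU2 → ℝ} (hg : Measurable g) :
    Measurable fun p : GaugeConfig 3 1 SU2 × (Edge 3 L → Fin 3 → ℝ) => g (orthoTube L p.1 p.2) := hg.comp (measurable_orthoTube L)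

omit [NeZero L] in
/-- `v ↦ orthoTube u v` is measurable. [folklore] -/
theorem measurable_orthoTube_right (u : GaugeConfig 3 1 SU2) : Measurable fun v : Edge 3 L → Fin 3 → ℝ => orthoTube L u v := by
  haveI : SecondCountableTopology SU2 := secondCountableTopology_su2
  refine measurable_pi_lambda _ fun e => ?_
  simp only [orthoTube]
  exact (continuous_chartSU2.measurable.comp (measurable_pi_apply e)).mul measurable_const

/-- The fibre integrand `v ↦ f(orthoTube u v)·Ω(v)·w(orthoTube u v)` is integrable (bounded measurable data). [folklore] -/
theorem integrable_fibreIntegrand {w : GaugeConfig 3 L SU2 → ℝ} (hw : Measurable w) {Cw : ℝ} (hCw : ∀ U, |w U| ≤ Cw) {Ω : LinkSpace L → ℝ} (hΩ : Measurable Ω) {CΩ : ℝ}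
    (hCΩ : ∀ x, |Ω x| ≤ CΩ) {f : GaugeConfig 3 L SU2 → ℝ} (hf : Measurable f) {Cf : ℝ} (hCf : ∀ U, |f U| ≤ Cf) (u : GaugeConfig 3 1 SU2) :
    Integrable (fun v => f (orthoTube L u v) * Ω (linkEmbed L v) * w (orthoTube L u v)) (orthoTransverse L) := by
  haveI := isFiniteMeasure_orthoTransverse L
  have hCf0 : 0 ≤ Cf := (abs_nonneg _).trans (hCf 1)
  have hCΩ0 : 0 ≤ CΩ := (abs_nonneg _).trans (hCΩ 0)
  exact integrable_of_measurable_abs_le _ (((hf.comp (measurable_orthoTube_right u)).mul (hΩ.comp (measurable_linkEmbed L))).mul (hw.comp (measurable_orthoTube_right u)))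
    (C := Cf * CΩ * Cw) fun v => by
      rw [abs_mul, abs_mul]; exact mul_le_mul (mul_le_mul (hCf _) (hCΩ _) (abs_nonneg _) hCf0) (hCw _) (abs_nonneg _) (mul_nonneg hCf0 hCΩ0)

/-- The fibre pairing is a measurable function of the slow variable. [folklore] -/
theorem measurable_fibreInner {w : GaugeConfig 3 L SU2 → ℝ} (hw : Measurable w) {Ω : LinkSpace L → ℝ} (hΩ : Measurable Ω) {f : GaugeConfig 3 L SU2 → ℝ} (hf : Measurable f) :
    Measurable (fibreInner L w Ω f) := by
  haveI := isFiniteMeasure_orthoTransverse L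
  have hJ : Measurable fun p : GaugeConfig 3 1 SU2 × (Edge 3 L → Fin 3 → ℝ) => f (orthoTube L p.1 p.2) * Ω (linkEmbed L p.2) * w (orthoTube L p.1 p.2) :=
    ((measurable_comp_orthoTube hf).mul (hΩ.comp ((measurable_linkEmbed L).comp measurable_snd))).mul (measurable_comp_orthoTube hw)
  exact (hJ.stronglyMeasurable.integral_prod_right' (ν := orthoTransverse L)).measurable

/-- The fibre mass is a measurable function of the slow variable. [folklore] -/
theorem measurable_fibreMass {w : GaugeConfig 3 L SU2 → ℝ} (hw : Measurable w) {Ω : LinkSpace L → ℝ} (hΩ : Measurable Ω) : Measurable (fibreMass L w Ω) := by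
  haveI := isFiniteMeasure_orthoTransverse L
  have hJ : Measurable fun p : GaugeConfig 3 1 SU2 × (Edge 3 L → Fin 3 → ℝ) => Ω (linkEmbed L p.2) ^ 2 * w (orthoTube L p.1 p.2) :=
    ((hΩ.comp ((measurable_linkEmbed L).comp measurable_snd)).pow_const 2).mul (measurable_comp_orthoTube hw)
  exact (hJ.stronglyMeasurable.integral_prod_right' (ν := orthoTransverse L)).measurable

/-- `|fibreInner| ≤ Cf·CΩ·Cw·π(univ)`. [folklore] -/
theorem abs_fibreInner_le {w : GaugeConfig 3 L SU2 → ℝ} {Cw : ℝ} (hCw : ∀ U, |w U| ≤ Cw) {Ω : LinkSpace L → ℝ} {CΩ : ℝ} (hCΩ : ∀ x, |Ω x| ≤ CΩ)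
    {f : GaugeConfig 3 L SU2 → ℝ} {Cf : ℝ} (hCf : ∀ U, |f U| ≤ Cf) (u : GaugeConfig 3 1 SU2) :
    |fibreInner L w Ω f u| ≤ Cf * CΩ * Cw * (orthoTransverse L).real Set.univ := by
  haveI := isFiniteMeasure_orthoTransverse L
  have hCf0 : 0 ≤ Cf := (abs_nonneg _).trans (hCf 1)
  have hCΩ0 : 0 ≤ CΩ := (abs_nonneg _).trans (hCΩ 0)
  unfold fibreInner
  calc |∫ v, f (orthoTube L u v) * Ω (linkEmbed L v) * w (orthoTube L u v) ∂orthoTransverse L|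
      ≤ ∫ v, |f (orthoTube L u v) * Ω (linkEmbed L v) * w (orthoTube L u v)| ∂orthoTransverse L := abs_integral_le_integral_abs
    _ ≤ ∫ _v, Cf * CΩ * Cw ∂orthoTransverse L := by
        refine integral_mono_of_nonneg (ae_of_all _ fun v => abs_nonneg _) (integrable_const _) (ae_of_all _ fun v => ?_)
        show |f (orthoTube L u v) * Ω (linkEmbed L v) * w (orthoTube L u v)| ≤ Cf * CΩ * Cw
        rw [abs_mul, abs_mul]
        exact mul_le_mul (mul_le_mul (hCf _) (hCΩ _) (abs_nonneg _) hCf0) (hCw _) (abs_nonneg _) (by positivity)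
    _ = Cf * CΩ * Cw * (orthoTransverse L).real Set.univ := by rw [integral_const, smul_eq_mul, mul_comm]

/-- `boCoeff` is measurable. [folklore] -/
theorem measurable_boCoeff {w : GaugeConfig 3 L SU2 → ℝ} (hw : Measurable w) {Ω : LinkSpace L → ℝ} (hΩ : Measurable Ω) {𝒰 : Set (GaugeConfig 3 1 SU2)} (h𝒰 : MeasurableSet 𝒰)
    {f : GaugeConfig 3 L SU2 → ℝ} (hf : Measurable f) : Measurable (boCoeff L w Ω 𝒰 f) :=
  ((measurable_fibreInner hw hΩ hf).div (measurable_fibreMass hw hΩ)).indicator h𝒰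

/-- `|boCoeff| ≤ Cf·CΩ·Cw·π(univ)/Z₀` when `fibreMass ≥ Z₀ > 0` on `𝒰`. [folklore] -/
theorem abs_boCoeff_le {w : GaugeConfig 3 L SU2 → ℝ} {Cw : ℝ} (hCw : ∀ U, |w U| ≤ Cw) {Ω : LinkSpace L → ℝ} {CΩ : ℝ} (hCΩ : ∀ x, |Ω x| ≤ CΩ) {𝒰 : Set (GaugeConfig 3 1 SU2)}
    {Z₀ : ℝ} (hZ₀ : 0 < Z₀) (hZ : ∀ u ∈ 𝒰, Z₀ ≤ fibreMass L w Ω u) {f : GaugeConfig 3 L SU2 → ℝ} {Cf : ℝ} (hCf : ∀ U, |f U| ≤ Cf) (u : GaugeConfig 3 1 SU2) :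
    |boCoeff L w Ω 𝒰 f u| ≤ Cf * CΩ * Cw * (orthoTransverse L).real Set.univ / Z₀ := by
  have hnum := abs_fibreInner_le hCw hCΩ hCf u
  have hnum0 : 0 ≤ Cf * CΩ * Cw * (orthoTransverse L).real Set.univ := (abs_nonneg _).trans hnum
  unfold boCoeff
  by_cases hu : u ∈ 𝒰
  · rw [Set.indicator_of_mem hu, abs_div, abs_of_pos (hZ₀.trans_le (hZ u hu))]
    exact div_le_div₀ hnum0 hnum hZ₀ (hZ u hu)
  · rw [Set.indicator_of_notMem hu, abs_zero]; positivity

/-- ★ LINEARITY: `boCoeff (Σ aᵢ fᵢ) = Σ aᵢ boCoeff fᵢ` (bounded measurable `fᵢ`). [folklore] -/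
theorem boCoeff_sum {w : GaugeConfig 3 L SU2 → ℝ} (hw : Measurable w) {Cw : ℝ} (hCw : ∀ U, |w U| ≤ Cw) {Ω : LinkSpace L → ℝ} (hΩ : Measurable Ω) {CΩ : ℝ}
    (hCΩ : ∀ x, |Ω x| ≤ CΩ) (𝒰 : Set (GaugeConfig 3 1 SU2)) {k : ℕ} (a : Fin k → ℝ) {f : Fin k → GaugeConfig 3 L SU2 → ℝ} (hf : ∀ i, Measurable (f i))
    (hfb : ∀ i, ∃ C : ℝ, ∀ U, |f i U| ≤ C) (u : GaugeConfig 3 1 SU2) :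
    boCoeff L w Ω 𝒰 (fun U => ∑ i, a i * f i U) u = ∑ i, a i * boCoeff L w Ω 𝒰 (f i) u := by
  haveI := isFiniteMeasure_orthoTransverse L
  have hlin : fibreInner L w Ω (fun U => ∑ i, a i * f i U) u = ∑ i, a i * fibreInner L w Ω (f i) u := by
    unfold fibreInner
    have hint : ∀ i, Integrable (fun v => f i (orthoTube L u v) * Ω (linkEmbed L v) * w (orthoTube L u v)) (orthoTransverse L) := fun i => by
      obtain ⟨C, hC⟩ := hfb i
      exact integrable_fibreIntegrand hw hCw hΩ hCΩ (hf i) hC u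
    calc ∫ v, (∑ i, a i * f i (orthoTube L u v)) * Ω (linkEmbed L v) * w (orthoTube L u v) ∂orthoTransverse L
        = ∫ v, ∑ i, a i * (f i (orthoTube L u v) * Ω (linkEmbed L v) * w (orthoTube L u v)) ∂orthoTransverse L := by
          refine integral_congr_ae (ae_of_all _ fun v => ?_)
          dsimp only
          rw [Finset.sum_mul, Finset.sum_mul]
          exact Finset.sum_congr rfl fun i _ => by ring
      _ = ∑ i, ∫ v, a i * (f i (orthoTube L u v) * Ω (linkEmbed L v) * w (orthoTube L u v)) ∂orthoTransverse L :=
          integral_finsetSum _ fun i _ => (hint i).const_mul (a i)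
      _ = ∑ i, a i * ∫ v, f i (orthoTube L u v) * Ω (linkEmbed L v) * w (orthoTube L u v) ∂orthoTransverse L :=
          Finset.sum_congr rfl fun i _ => integral_const_mul _ _
  unfold boCoeff
  by_cases hu : u ∈ 𝒰
  · simp only [Set.indicator_of_mem hu, hlin, Finset.sum_div, mul_div_assoc]
  · simp only [Set.indicator_of_notMem hu, mul_zero, Finset.sum_const_zero]

/-- ★ LINEARITY of the projection: `boProj (Σ aᵢ fᵢ) = Σ aᵢ boProj fᵢ` pointwise. [folklore] -/
theorem boProj_sum {w : GaugeConfig 3 L SU2 → ℝ} (hw : Measurable w) {Cw : ℝ} (hCw : ∀ U, |w U| ≤ Cw) {Ω : LinkSpace L → ℝ} (hΩ : Measurable Ω) {CΩ : ℝ}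
    (hCΩ : ∀ x, |Ω x| ≤ CΩ) (𝒰 : Set (GaugeConfig 3 1 SU2)) {k : ℕ} (a : Fin k → ℝ) {f : Fin k → GaugeConfig 3 L SU2 → ℝ} (hf : ∀ i, Measurable (f i))
    (hfb : ∀ i, ∃ C : ℝ, ∀ U, |f i U| ≤ C) (U : GaugeConfig 3 L SU2) :
    boProj L w Ω 𝒰 (fun V => ∑ i, a i * f i V) U = ∑ i, a i * boProj L w Ω 𝒰 (f i) U := by
  unfold boProj boFun
  rw [boCoeff_sum hw hCw hΩ hCΩ 𝒰 a hf hfb]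
  simp only [Finset.sum_mul, Finset.mul_sum]
  exact Finset.sum_congr rfl fun i _ => by ring

/-! ## §3 ★★ The one-site disintegration of pairings with BO functions -/

/-- ★★ **`∫ boFun φ Ω · g · w = ∫ φ(u)·fibreInner w Ω g u du`** (bounded measurable data): exact one-site disintegration on the orthographic tube followed by Fubini.
[cite: Luscher1983, §3] -/
theorem integral_boFun_mul_eq {φ : GaugeConfig 3 1 SU2 → ℝ} (hφ : Measurable φ) {Cφ : ℝ} (hCφ : ∀ u, |φ u| ≤ Cφ) {Ω : LinkSpace L → ℝ} (hΩ : Measurable Ω) {CΩ : ℝ}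
    (hCΩ : ∀ x, |Ω x| ≤ CΩ) {g w : GaugeConfig 3 L SU2 → ℝ} (hg : Measurable g) {Cg : ℝ} (hCg : ∀ U, |g U| ≤ Cg) (hw : Measurable w) {Cw : ℝ} (hCw : ∀ U, |w U| ≤ Cw) :
    ∫ U, boFun L φ Ω U * g U * w U ∂configMeasure SU2 L = ∫ u, φ u * fibreInner L w Ω g u ∂configMeasure SU2 1 := by
  haveI := isFiniteMeasure_orthoTransverse L
  have hCφ0 : 0 ≤ Cφ := (abs_nonneg _).trans (hCφ 1)
  have hCΩ0 : 0 ≤ CΩ := (abs_nonneg _).trans (hCΩ 0)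
  have hCg0 : 0 ≤ Cg := (abs_nonneg _).trans (hCg 1)
  -- Step 1: disintegrate
  have hFm : Measurable fun U => boFun L φ Ω U * g U * w U := ((measurable_boFun L hφ hΩ).mul hg).mul hw
  have hFb : ∀ U, |boFun L φ Ω U * g U * w U| ≤ Cφ * CΩ * Cg * Cw := fun U => by
    rw [abs_mul, abs_mul]
    exact mul_le_mul (mul_le_mul (abs_boFun_le L hCφ hCΩ U) (hCg U) (abs_nonneg _) (by positivity)) (hCw U) (abs_nonneg _) (by positivity)
  have hF0 : ∀ U, U ∉ orthoTubeSet L → boFun L φ Ω U * g U * w U = 0 := fun U hU => by rw [boFun_eq_zero_of_not_mem L φ Ω hU, zero_mul, zero_mul]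
  rw [integral_configMeasure_orthoTube L hFm ⟨_, hFb⟩ hF0]
  -- Step 2: rewrite the integrand on the tube (a.e. in `v`: the transverse measure is carried by the cap)
  have hae : ∀ᵐ v ∂orthoTransverse L, v ∈ capBalancedSet L := by
    rw [ae_iff]
    exact orthoTransverse_compl_capBalancedSet L
  have h1 : ∫ v, ∫ u, boFun L φ Ω (orthoTube L u v) * g (orthoTube L u v) * w (orthoTube L u v) ∂configMeasure SU2 1 ∂orthoTransverse L =
      ∫ v, ∫ u, φ u * (g (orthoTube L u v) * Ω (linkEmbed L v) * w (orthoTube L u v)) ∂configMeasure SU2 1 ∂orthoTransverse L := by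
    refine integral_congr_ae (hae.mono fun v hv => ?_)
    refine integral_congr_ae (ae_of_all _ fun u => ?_)
    dsimp only
    rw [boFun_orthoTube L φ Ω u hv]; ring
  rw [h1]
  -- Step 3: Fubini (bounded measurable integrand on a product of finite measures)
  have hGm : Measurable (Function.uncurry fun (v : Edge 3 L → Fin 3 → ℝ) (u : GaugeConfig 3 1 SU2) =>
      φ u * (g (orthoTube L u v) * Ω (linkEmbed L v) * w (orthoTube L u v))) := by
    have hO : Measurable fun p : (Edge 3 L → Fin 3 → ℝ) × GaugeConfig 3 1 SU2 => orthoTube L p.2 p.1 := by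
      haveI : SecondCountableTopology SU2 := secondCountableTopology_su2
      refine measurable_pi_lambda _ fun e => ?_
      simp only [orthoTube]
      exact (continuous_chartSU2.measurable.comp ((measurable_pi_apply e).comp measurable_fst)).mul ((measurable_pi_apply _).comp measurable_snd)
    exact (hφ.comp measurable_snd).mul (((hg.comp hO).mul (hΩ.comp ((measurable_linkEmbed L).comp measurable_fst))).mul (hw.comp hO))
  have hGb : ∀ p : (Edge 3 L → Fin 3 → ℝ) × GaugeConfig 3 1 SU2,
      |(Function.uncurry fun (v : Edge 3 L → Fin 3 → ℝ) (u : GaugeConfig 3 1 SU2) => φ u * (g (orthoTube L u v) * Ω (linkEmbed L v) * w (orthoTube L u v))) p| ≤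
        Cφ * (Cg * CΩ * Cw) := fun p => by
    simp only [Function.uncurry]
    rw [abs_mul]
    have hin : |g (orthoTube L p.2 p.1) * Ω (linkEmbed L p.1) * w (orthoTube L p.2 p.1)| ≤ Cg * CΩ * Cw := by
      rw [abs_mul, abs_mul]
      exact mul_le_mul (mul_le_mul (hCg _) (hCΩ _) (abs_nonneg _) hCg0) (hCw _) (abs_nonneg _) (by positivity)
    exact mul_le_mul (hCφ _) hin (abs_nonneg _) hCφ0
  have hint := integrable_of_measurable_abs_le ((orthoTransverse L).prod (configMeasure SU2 1)) hGm hGb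
  rw [integral_integral_swap hint]
  -- Step 4: pull `φ u` out of the fibre integral
  refine integral_congr_ae (ae_of_all _ fun u => ?_)
  dsimp only
  unfold fibreInner
  exact integral_const_mul _ _

/-! ## §4 ★★★ Exact Pythagoras for the projection -/

/-- `⟨Pf, g⟩_w = ∫ boCoeff f · fibreInner g`. [folklore] -/
theorem integral_boProj_mul {w : GaugeConfig 3 L SU2 → ℝ} (hw : Measurable w) {Cw : ℝ} (hCw : ∀ U, |w U| ≤ Cw) {Ω : LinkSpace L → ℝ} (hΩ : Measurable Ω) {CΩ : ℝ}
    (hCΩ : ∀ x, |Ω x| ≤ CΩ) {𝒰 : Set (GaugeConfig 3 1 SU2)} (h𝒰 : MeasurableSet 𝒰) {Z₀ : ℝ} (hZ₀ : 0 < Z₀) (hZ : ∀ u ∈ 𝒰, Z₀ ≤ fibreMass L w Ω u)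
    {f g : GaugeConfig 3 L SU2 → ℝ} (hf : Measurable f) {Cf : ℝ} (hCf : ∀ U, |f U| ≤ Cf) (hg : Measurable g) {Cg : ℝ} (hCg : ∀ U, |g U| ≤ Cg) :
    ∫ U, boProj L w Ω 𝒰 f U * g U * w U ∂configMeasure SU2 L = ∫ u, boCoeff L w Ω 𝒰 f u * fibreInner L w Ω g u ∂configMeasure SU2 1 :=
  integral_boFun_mul_eq (measurable_boCoeff hw hΩ h𝒰 hf) (abs_boCoeff_le hCw hCΩ hZ₀ hZ hCf) hΩ hCΩ hg hCg hw hCw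

/-- The fibre pairing of a BO function with itself-type data: `fibreInner w Ω (boFun φ Ω) u = φ u · fibreMass w Ω u`. [folklore] -/
theorem fibreInner_boFun {w : GaugeConfig 3 L SU2 → ℝ} (φ : GaugeConfig 3 1 SU2 → ℝ) (Ω : LinkSpace L → ℝ) (u : GaugeConfig 3 1 SU2) :
    fibreInner L w Ω (boFun L φ Ω) u = φ u * fibreMass L w Ω u := by
  haveI := isFiniteMeasure_orthoTransverse L
  unfold fibreInner fibreMass
  rw [← integral_const_mul]
  have hae : ∀ᵐ v ∂orthoTransverse L, v ∈ capBalancedSet L := by rw [ae_iff]; exact orthoTransverse_compl_capBalancedSet L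
  refine integral_congr_ae (hae.mono fun v hv => ?_)
  show boFun L φ Ω (orthoTube L u v) * Ω (linkEmbed L v) * w (orthoTube L u v) = φ u * (Ω (linkEmbed L v) ^ 2 * w (orthoTube L u v))
  rw [boFun_orthoTube L φ Ω u hv]; ring

/-- ★★ `⟨Pf, f⟩_w = ⟨Pf, Pf⟩_w` — the projection property. [folklore] -/
theorem integral_boProj_mul_self_eq {w : GaugeConfig 3 L SU2 → ℝ} (hw : Measurable w) {Cw : ℝ} (hCw : ∀ U, |w U| ≤ Cw) {Ω : LinkSpace L → ℝ} (hΩ : Measurable Ω) {CΩ : ℝ}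
    (hCΩ : ∀ x, |Ω x| ≤ CΩ) {𝒰 : Set (GaugeConfig 3 1 SU2)} (h𝒰 : MeasurableSet 𝒰) {Z₀ : ℝ} (hZ₀ : 0 < Z₀) (hZ : ∀ u ∈ 𝒰, Z₀ ≤ fibreMass L w Ω u)
    {f : GaugeConfig 3 L SU2 → ℝ} (hf : Measurable f) {Cf : ℝ} (hCf : ∀ U, |f U| ≤ Cf) :
    ∫ U, boProj L w Ω 𝒰 f U * f U * w U ∂configMeasure SU2 L = ∫ U, boProj L w Ω 𝒰 f U * boProj L w Ω 𝒰 f U * w U ∂configMeasure SU2 L := by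
  have hPm : Measurable (boProj L w Ω 𝒰 f) := measurable_boFun L (measurable_boCoeff hw hΩ h𝒰 hf) hΩ
  have hPb := abs_boFun_le L (abs_boCoeff_le hCw hCΩ hZ₀ hZ hCf) hCΩ
  rw [integral_boProj_mul hw hCw hΩ hCΩ h𝒰 hZ₀ hZ hf hCf hf hCf, integral_boProj_mul hw hCw hΩ hCΩ h𝒰 hZ₀ hZ hf hCf hPm hPb]
  refine integral_congr_ae (ae_of_all _ fun u => ?_)
  dsimp only
  unfold boProj
  rw [fibreInner_boFun]
  -- `c · I = c · (c · Z)` with `c = 𝟙_𝒰 I/Z`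
  unfold boCoeff
  by_cases hu : u ∈ 𝒰
  · rw [Set.indicator_of_mem hu]
    have hZu : fibreMass L w Ω u ≠ 0 := (hZ₀.trans_le (hZ u hu)).ne'
    field_simp
  · rw [Set.indicator_of_notMem hu, zero_mul, zero_mul]

/-- ★★★ **EXACT PYTHAGORAS (the MASS clause)**: `tubeNormSq w (Pf) + tubeNormSq w (f − Pf) = tubeNormSq w f` for bounded measurable `f`, `w`, `Ω`, measurable `𝒰` with
`fibreMass ≥ Z₀ > 0` on `𝒰`. [cite: SjostrandZworski2007, §2] -/
theorem tubeNormSq_boProj_add {w : GaugeConfig 3 L SU2 → ℝ} (hw : Measurable w) {Cw : ℝ} (hCw : ∀ U, |w U| ≤ Cw) {Ω : LinkSpace L → ℝ} (hΩ : Measurable Ω) {CΩ : ℝ}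
    (hCΩ : ∀ x, |Ω x| ≤ CΩ) {𝒰 : Set (GaugeConfig 3 1 SU2)} (h𝒰 : MeasurableSet 𝒰) {Z₀ : ℝ} (hZ₀ : 0 < Z₀) (hZ : ∀ u ∈ 𝒰, Z₀ ≤ fibreMass L w Ω u)
    {f : GaugeConfig 3 L SU2 → ℝ} (hf : Measurable f) {Cf : ℝ} (hCf : ∀ U, |f U| ≤ Cf) :
    tubeNormSq w (boProj L w Ω 𝒰 f) + tubeNormSq w (fun U => f U - boProj L w Ω 𝒰 f U) = tubeNormSq w f := by
  have hPm : Measurable (boProj L w Ω 𝒰 f) := measurable_boFun L (measurable_boCoeff hw hΩ h𝒰 hf) hΩ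
  obtain hPb := abs_boFun_le L (abs_boCoeff_le hCw hCΩ hZ₀ hZ hCf) hCΩ
  set P := boProj L w Ω 𝒰 f with hPdef
  set CP : ℝ := Cf * CΩ * Cw * (orthoTransverse L).real Set.univ / Z₀ * CΩ with hCP
  have hCf0 : 0 ≤ Cf := (abs_nonneg _).trans (hCf 1)
  have hCP0 : 0 ≤ CP := (abs_nonneg _).trans (hPb 1)
  have hkey := integral_boProj_mul_self_eq hw hCw hΩ hCΩ h𝒰 hZ₀ hZ hf hCf
  -- integrability of the three products
  have hiPP : Integrable (fun U => P U * P U * w U) (configMeasure SU2 L) :=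
    integrable_of_measurable_abs_le _ ((hPm.mul hPm).mul hw) (C := CP * CP * Cw) fun U => by
      rw [abs_mul, abs_mul]; exact mul_le_mul (mul_le_mul (hPb U) (hPb U) (abs_nonneg _) hCP0) (hCw U) (abs_nonneg _) (by positivity)
  have hiPf : Integrable (fun U => P U * f U * w U) (configMeasure SU2 L) :=
    integrable_of_measurable_abs_le _ ((hPm.mul hf).mul hw) (C := CP * Cf * Cw) fun U => by
      rw [abs_mul, abs_mul]; exact mul_le_mul (mul_le_mul (hPb U) (hCf U) (abs_nonneg _) hCP0) (hCw U) (abs_nonneg _) (by positivity)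
  have hiff : Integrable (fun U => f U * f U * w U) (configMeasure SU2 L) :=
    integrable_of_measurable_abs_le _ ((hf.mul hf).mul hw) (C := Cf * Cf * Cw) fun U => by
      rw [abs_mul, abs_mul]; exact mul_le_mul (mul_le_mul (hCf U) (hCf U) (abs_nonneg _) hCf0) (hCw U) (abs_nonneg _) (by positivity)
  unfold tubeNormSq
  have e1 : (fun U => P U ^ 2 * w U) = fun U => P U * P U * w U := by funext U; ring
  have e2 : (fun U => (f U - P U) ^ 2 * w U) = fun U => f U * f U * w U - 2 * (P U * f U * w U) + P U * P U * w U := by funext U; ring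
  have e3 : (fun U => f U ^ 2 * w U) = fun U => f U * f U * w U := by funext U; ring
  have hcm : Integrable (fun U => 2 * (P U * f U * w U)) (configMeasure SU2 L) := hiPf.const_mul 2
  have hsub : Integrable (fun U => f U * f U * w U - 2 * (P U * f U * w U)) (configMeasure SU2 L) := hiff.sub hcm
  rw [e1, e2, e3, integral_add hsub hiPP, integral_sub hiff hcm, integral_const_mul, hkey]
  ring

/-- ★ The remainder `v = f − Pf` is fibrewise `w`-orthogonal to `Ω` over `𝒰`: `fibreInner w Ω (f − Pf) u = 0` for `u ∈ 𝒰`. [folklore] -/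
theorem fibreInner_sub_boProj {w : GaugeConfig 3 L SU2 → ℝ} (hw : Measurable w) {Cw : ℝ} (hCw : ∀ U, |w U| ≤ Cw) {Ω : LinkSpace L → ℝ} (hΩ : Measurable Ω) {CΩ : ℝ}
    (hCΩ : ∀ x, |Ω x| ≤ CΩ) {𝒰 : Set (GaugeConfig 3 1 SU2)} (h𝒰 : MeasurableSet 𝒰) {Z₀ : ℝ} (hZ₀ : 0 < Z₀) (hZ : ∀ u ∈ 𝒰, Z₀ ≤ fibreMass L w Ω u)
    {f : GaugeConfig 3 L SU2 → ℝ} (hf : Measurable f) {Cf : ℝ} (hCf : ∀ U, |f U| ≤ Cf) {u : GaugeConfig 3 1 SU2} (hu : u ∈ 𝒰) :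
    fibreInner L w Ω (fun U => f U - boProj L w Ω 𝒰 f U) u = 0 := by
  have hPm : Measurable (boProj L w Ω 𝒰 f) := measurable_boFun L (measurable_boCoeff hw hΩ h𝒰 hf) hΩ
  have hPb := abs_boFun_le L (abs_boCoeff_le hCw hCΩ hZ₀ hZ hCf) hCΩ
  have h1 := integrable_fibreIntegrand hw hCw hΩ hCΩ hf hCf u
  have h2 := integrable_fibreIntegrand hw hCw hΩ hCΩ hPm hPb u
  have hsub : fibreInner L w Ω (fun U => f U - boProj L w Ω 𝒰 f U) u = fibreInner L w Ω f u - fibreInner L w Ω (boProj L w Ω 𝒰 f) u := by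
    unfold fibreInner
    rw [← integral_sub h1 h2]
    refine integral_congr_ae (ae_of_all _ fun v => ?_)
    dsimp only; ring
  rw [hsub]
  unfold boProj
  rw [fibreInner_boFun]
  unfold boCoeff
  rw [Set.indicator_of_mem hu, div_mul_cancel₀ _ (hZ₀.trans_le (hZ u hu)).ne', sub_self]

end Summit.QuantumFields.YangMills.Theorems.FemtoTransferGap.TwoLattice.ConstTube

end
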